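import Summits.QuantumFields.BalabanUV.Beta.D1BFx.CovariantLaplacianJets

/-!
# `BalabanUV.Beta.D1BFx.CoframeFactorJets` — road «BF-x» for binder row D1, slot (K), X₃(ii) ROUTE T, owner row **«TB4-W» «THE WEIGHT JETS OF THE
# CANONICAL CO-FRAME»** (`HOME/b2b-balaban-beta-d1-p2/K-ASSEMBLY-SPEC-v2.md` v2.5 §3 (T3), owner ruling ρ-g6-12 (1), journal l.23228), PART 1b — THE `ℤ⁴`
# JETS OF THE CO-FRAME FACTOR `M(U) = L_U D_U*` (site rows, bond columns) TO SECOND ORDER, IN CLOSED FORM: `cof₀ = lap₀∘D₀ᵀ`, `cof₁ = lap₁∘D₀ᵀ − lap₀∘Ḋᵀ`,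
# `cof₁₁ = lap₁₁∘D₀ᵀ − (lap₁∘Ḋ′ᵀ + lap₁′∘Ḋᵀ) + [b = b′]•lap₀∘Ḋᵀ` — the tables whose torus images, sandwiched by the fixed basis `Nᵀ`, are the co-frame
# jets `T•` of K-TA4G (R2) (`T(U) = NᵀL_U D_U*`, `TorusZerothJunction`'s `T₀ = NᵀL̂D̂ₛᵀ` at `U = 1`)

HONEST DEPENDENCY (cell records, verbatim): «continuum YM on T⁴ ⇐ BetaPertH ∧ nine spine estimates (0/9 proved); BetaPertH ⇐ (D1) ∧ (D4) ∧
CAP+tail; G-an2-4 gates asym, D1 and NE2/3/4.»  HONEST FRAMING (cell contract, verbatim): «discharging `BetaPertH` makes Bałaban's UV stability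
UNCONDITIONAL — a real constructive-QFT result; it is NOT the continuum limit and NOT the Clay problem.»  THIS MODULE DISCHARGES NOTHING of (K),
of D1 or of the wall: [our object] data definitions (finite `ℤ⁴` stencils in closed form, asserting nothing) and [folklore] finite stencil algebra
over PART 1 `CovariantLaplacianJets` (`djF`, `lap₀`, `lap₁`, `lap₂`, `lap₁₁`, the column actions) BY NAME.  THE CONVENTION of PART 1 (colour-stripped
jets in the plane model, `Cᵀ = −C`, `C² = −1`) fixes the signs: the adjoint jets are `(D*)₀ = D₀ᵀ`, `(D*)ₜ = −Ḋ′ᵀ`, `(D*)ₛₜ = +[b = b′]•Ḋᵀ`, so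
`M_st = L_st(D*)₀ + L_s(D*)_t + L_t(D*)_s + L₀(D*)_st` reads as displayed in the title.  No `def … : Prop`, nothing cited, no wall binder instantiated,
0 sorry.  0∕4 binders of row D1; (K) NOT closed; NOT D1, NOT BetaPertH, NOT continuum, NOT Clay.

ABSOLUTE RULE (cell charter, verbatim): «No internally-minted statement may enter as a cited fact. Every hypothesis is either kernel-proved in this
package or a verbatim quotation of a PUBLISHED theorem with page reference. The manuscript(s) under audit are NOT citable for their own disputed
steps — they are the thing under adjudication; programme-internal (2001/route/tribunal) claims are never citable.»

CONTENT: §1 the column actions of `D₀ᵀ = trF dzF` and `Ḋᵀ = trF (djF κ u)` on a fibred site kernel (`compF_trF_dzF_apply`, `compF_trF_djF_apply`);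
§2 [our object] `cof₀`, `cof₁ κ u`, `cof₁₁ κ u l u′` in closed form and the DERIVATIONS `cof₀_eq_jets`, `cof₁_eq_jets`, `cof₁₁_eq_jets`, `cof₁₁_self_eq_jets`
(the pure second jet = the diagonal, for the (ss)∕(tt) slots of `GramWeightJetsMixed.hessT_gramTransfer_jets`); §3 THE FORMAL ANCHOR OF THE SIGN
DICTIONARY: **`toF_dJetSw_eq_jets : toF (RJetAssembly.dJetSw κ u Y) = compF (compF dzF (toF Y)) (trF (djF κ u)) − compF (compF (djF κ u) (toF Y)) (trF dzF)`**
— leaf-05-g3's BOND-level rule for the jet of `D∘Y∘D*` is `dYḊᵀ − ḊYdᵀ` (both sides finite sums; no Fubini).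
THE SIGN DICTIONARY (INFO «TB4-W-SIGN», journal 2026-08-21): the stripped first-order sign is a convention `ε = ±1`, `D_s = ε·Ḋ ⊗ C`; every FIRST-order
stripped object flips with `ε`, zeroth∕second-order objects are `ε`-free, and inside one trace only the RELATIVE `ε` of the summands matters.  PART 1 and
this file use `ε = +1` (`djMat`'s docstring; `lap₁ = +dJetSite = +ghCur`, the SITE-level pin).  Under `ε = +1` the jet of `D∘Y∘D*` is `D_sYD₀ᵀ + D₀Y(D*)_s =
ḊYdᵀ − dYḊᵀ = −dJetSw` (§3), so J5's BOND-level tables (`RJetAssembly.dJetSw`∕`RjetOf`) are `ε = −1`; an assembler adding the co-frame weight jets of this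
row to M-side tables of the `ε = −1` convention reads `Bₛ := gram₁ T₀ (−T₁) A₀ (−A₁) = −gram₁ T₀ T₁ A₀ A₁` (odd) and `Bₛₜ := gramMix …` unchanged (even).
NOT HERE (PART 2 `TorusCoframeJets`): torus images, the `N`-sandwich, the Gram ∕ inverse jets, the junction with `TorusZerothJunction`.
Provenance: D1 formalisation swarm, unit `b2b-balaban-beta-d1-formalise-leaf-03` (gen 9), claim «TB4-W» journal l.23490, 2026-08-20.
-/

noncomputable section

namespace Summit.QuantumFields.BalabanUV.Beta.D1BFx.CoframeFactorJets

open Literature.MathematicalPhysics.QuantumFieldTheory.Balaban1983to89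
open Literature.MathematicalPhysics.QuantumFieldTheory.Balaban1983to89.Beta
open ExpKernelCalculus (Site MKer)
open AffineAveraging (unitVec)
open B6QGQLower276 (lapKer)
open Summit.QuantumFields.BalabanUV.Beta.D1BFx.FibredPeriodisation (FKer Kfib Kfib_apply compF)
open Summit.QuantumFields.BalabanUV.Beta.D1BFx.SortedKernels (trF trF_apply)
open Summit.QuantumFields.BalabanUV.Beta.D1BFx.StencilKernels (dzKer)
open Summit.QuantumFields.BalabanUV.Beta.D1BFx.TorusGaugeBasisMatrix (dzF tsum_dzKer_mul)
open Summit.QuantumFields.BalabanUV.Beta.D1BFx.RJetAssembly (djMat tsum_djMat_mul dJetSw dJetSw_apply)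
open Summit.QuantumFields.BalabanUV.Beta.D1BFx.PeriodicArrays (toF toF_apply)
open Summit.QuantumFields.BalabanUV.Beta.D1BFx.GhostStencil (ghCur ghCur_apply)
open Summit.QuantumFields.BalabanUV.Beta.D1BFx.CovariantLaplacianJets (djF djF_apply lap₀ lap₀_apply lap₁ lap₁_apply lap₂ lap₁₁ lap₁₁_self)
open scoped BigOperators

variable (κ : Fin 4) (u : Site 4)

/-! ## §1 Column actions of `D₀ᵀ` and `Ḋᵀ` on a fibred site kernel -/

/-- [folklore] COLUMN ACTION of `D₀ᵀ`: `Σ'_w f w · dzKer β z w = f (z + e_β) − f z` (`TorusGaugeBasisMatrix.tsum_dzKer_mul`). -/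
theorem tsum_mul_dzKer (β : Fin 4) (z : Site 4) (f : Site 4 → ℝ) : ∑' w, f w * dzKer β z w = f (z + unitVec β) - f z := by
  simp_rw [mul_comm (f _) _]
  exact tsum_dzKer_mul (d := 3) β z f

/-- [folklore] COLUMN ACTION of `Ḋᵀ`: `Σ'_w f w · djMat κ u z β w = [z = u ∧ β = κ]·f (u + e_κ)` (`RJetAssembly.tsum_djMat_mul`). -/
theorem tsum_mul_djMat (z : Site 4) (β : Fin 4) (f : Site 4 → ℝ) :
    ∑' w, f w * djMat κ u z β w = if z = u ∧ β = κ then f (u + unitVec κ) else 0 := by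
  simp_rw [mul_comm (f _) _]
  exact tsum_djMat_mul κ u z β f

/-- [folklore] Composition of a fibred site kernel with `D₀ᵀ = trF dzF`, in closed form. -/
theorem compF_trF_dzF_apply (Y : FKer 4 Unit Unit) (x z : Site 4) (a : Unit) (β : Fin 4) :
    compF Y (trF (dzF (d := 3))) (x, a) (z, β) = Y (x, a) (z + unitVec β, ()) - Y (x, a) (z, ()) := by
  simp only [compF, trF_apply, Finset.univ_unique, Finset.sum_singleton]
  exact tsum_mul_dzKer β z (fun w => Y (x, a) (w, ()))

/-- [folklore] Composition of a fibred site kernel with `Ḋᵀ = trF (djF κ u)`, in closed form. -/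
theorem compF_trF_djF_apply (Y : FKer 4 Unit Unit) (x z : Site 4) (a : Unit) (β : Fin 4) :
    compF Y (trF (djF κ u)) (x, a) (z, β) = if z = u ∧ β = κ then Y (x, a) (u + unitVec κ, ()) else 0 := by
  simp only [compF, trF_apply, Finset.univ_unique, Finset.sum_singleton]
  exact tsum_mul_djMat κ u z β (fun w => Y (x, a) (w, ()))

/-! ## §2 The co-frame factor and its jets, in closed form; the derivations -/

/-- [our object] **THE `U = 1` CO-FRAME FACTOR `M₀ = lap₀ ∘ D₀ᵀ`** IN CLOSED FORM: `cof₀ (x,⋆) (z,β) = lapKer x (z + e_β) − lapKer x z`.  A definition. -/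
def cof₀ : FKer 4 Unit (Fin 4) := fun i j => lapKer i.1 (j.1 + unitVec j.2) - lapKer i.1 j.1

/-- [our object] Unfolding `cof₀`. -/
@[simp] theorem cof₀_apply (x z : Site 4) (a : Unit) (β : Fin 4) : cof₀ (x, a) (z, β) = lapKer x (z + unitVec β) - lapKer x z := rfl

/-- [folklore] **`cof₀ = lap₀ ∘ D₀ᵀ`** (periodises to `L̂·D̂ᵀ`, the core of `TorusZerothJunction`'s `T₀ = NᵀL̂D̂ₛᵀ`). -/
theorem cof₀_eq_jets : cof₀ = compF lap₀ (trF (dzF (d := 3))) := by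
  funext ⟨x, a⟩ ⟨z, β⟩
  rw [compF_trF_dzF_apply, cof₀_apply, lap₀_apply, lap₀_apply]

/-- [our object] **THE STRIPPED FIRST JET OF THE CO-FRAME FACTOR** along `(κ,u)`, IN CLOSED FORM:
`cof₁ κ u (x,⋆) (z,β) = (ghCur κ u x (z+e_β) − ghCur κ u x z) − [z = u ∧ β = κ]·lapKer x (u + e_κ)`.  A definition; `cof₁_eq_jets`. -/
def cof₁ (κ : Fin 4) (u : Site 4) : FKer 4 Unit (Fin 4) := fun i j =>
  (ghCur κ u i.1 (j.1 + unitVec j.2) () () - ghCur κ u i.1 j.1 () ()) - (if j.1 = u ∧ j.2 = κ then lapKer i.1 (u + unitVec κ) else 0)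

/-- [our object] Unfolding `cof₁`. -/
@[simp] theorem cof₁_apply (x z : Site 4) (a : Unit) (β : Fin 4) : cof₁ κ u (x, a) (z, β)
    = (ghCur κ u x (z + unitVec β) () () - ghCur κ u x z () ()) - (if z = u ∧ β = κ then lapKer x (u + unitVec κ) else 0) := rfl

/-- [folklore] **THE FIRST-JET DERIVATION `cof₁ = lap₁ ∘ D₀ᵀ − lap₀ ∘ Ḋᵀ`** (`M₁ = L₁(D*)₀ + L₀(D*)₁`, THE CONVENTION (ii): `(D*)₁ = −Ḋᵀ`). -/
theorem cof₁_eq_jets : cof₁ κ u = compF (lap₁ κ u) (trF (dzF (d := 3))) - compF lap₀ (trF (djF κ u)) := by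
  funext ⟨x, a⟩ ⟨z, β⟩
  rw [Pi.sub_apply, Pi.sub_apply, compF_trF_dzF_apply, compF_trF_djF_apply, cof₁_apply, lap₁_apply, lap₁_apply, lap₀_apply]

/-- [our object] **THE STRIPPED MIXED SECOND JET OF THE CO-FRAME FACTOR** along `b = (κ,u)`, `b′ = (l,u′)`, IN CLOSED FORM:
`cof₁₁ (x,⋆) (z,β) = (lap₁₁(x, z+e_β) − lap₁₁(x, z)) − ([z = u′ ∧ β = l]·ghCur κ u x (u′+e_l) + [z = u ∧ β = κ]·ghCur l u′ x (u+e_κ))`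
`+ [b = b′]·[z = u ∧ β = κ]·lapKer x (u+e_κ)`.  A definition; `cof₁₁_eq_jets`.  (The pure second jet is the diagonal `cof₁₁ κ u κ u`.) -/
def cof₁₁ (κ : Fin 4) (u : Site 4) (l : Fin 4) (u' : Site 4) : FKer 4 Unit (Fin 4) := fun i j =>
  (lap₁₁ κ u l u' i (j.1 + unitVec j.2, ()) - lap₁₁ κ u l u' i (j.1, ()))
    - ((if j.1 = u' ∧ j.2 = l then ghCur κ u i.1 (u' + unitVec l) () () else 0)
        + (if j.1 = u ∧ j.2 = κ then ghCur l u' i.1 (u + unitVec κ) () () else 0))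
    + (if u = u' ∧ κ = l then (if j.1 = u ∧ j.2 = κ then lapKer i.1 (u + unitVec κ) else 0) else 0)

/-- [our object] Unfolding `cof₁₁`. -/
theorem cof₁₁_apply (l : Fin 4) (u' : Site 4) (x z : Site 4) (a : Unit) (β : Fin 4) : cof₁₁ κ u l u' (x, a) (z, β)
    = (lap₁₁ κ u l u' (x, a) (z + unitVec β, ()) - lap₁₁ κ u l u' (x, a) (z, ()))
      - ((if z = u' ∧ β = l then ghCur κ u x (u' + unitVec l) () () else 0)
          + (if z = u ∧ β = κ then ghCur l u' x (u + unitVec κ) () () else 0))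
      + (if u = u' ∧ κ = l then (if z = u ∧ β = κ then lapKer x (u + unitVec κ) else 0) else 0) := rfl

/-- [folklore] **THE MIXED-JET DERIVATION `cof₁₁ = lap₁₁ ∘ D₀ᵀ − (lap₁ ∘ Ḋ′ᵀ + lap₁′ ∘ Ḋᵀ) + [b = b′]•(lap₀ ∘ Ḋᵀ)`**
(`M_st = L_st(D*)₀ + L_s(D*)_t + L_t(D*)_s + L₀(D*)_st`, THE CONVENTION (ii): `(D*)_t = −Ḋ′ᵀ`, `(D*)_st = +[b=b′]•Ḋᵀ`). -/
theorem cof₁₁_eq_jets (l : Fin 4) (u' : Site 4) : cof₁₁ κ u l u'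
    = compF (lap₁₁ κ u l u') (trF (dzF (d := 3)))
      - (compF (lap₁ κ u) (trF (djF l u')) + compF (lap₁ l u') (trF (djF κ u)))
      + (if u = u' ∧ κ = l then compF lap₀ (trF (djF κ u)) else 0) := by
  funext ⟨x, a⟩ ⟨z, β⟩
  simp only [Pi.add_apply, Pi.sub_apply, ite_apply, Pi.zero_apply]
  rw [compF_trF_dzF_apply, compF_trF_djF_apply, compF_trF_djF_apply, cof₁₁_apply, lap₁_apply, lap₁_apply]
  by_cases h : u = u' ∧ κ = l
  · rw [if_pos h, if_pos h, compF_trF_djF_apply, lap₀_apply]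
  · rw [if_neg h, if_neg h]

/-- [folklore] The pure second jet of the co-frame factor is the diagonal of the mixed one; displayed for the (ss)∕(tt) slots of K-TA4G. -/
theorem cof₁₁_self_eq_jets : cof₁₁ κ u κ u
    = compF (lap₂ κ u) (trF (dzF (d := 3))) - (2 : ℝ) • compF (lap₁ κ u) (trF (djF κ u)) + compF lap₀ (trF (djF κ u)) := by
  rw [cof₁₁_eq_jets, lap₁₁_self, if_pos ⟨rfl, rfl⟩, two_smul]

/-! ## §3 The formal anchor of the sign dictionary: J5's bond-level rule is `dYḊᵀ − ḊYdᵀ` -/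

/-- [folklore] `compF dzF Ỹ` is the row action of `d` on the site kernel: `(D₀∘Ỹ)((x,α))(w) = Y (x+e_α) w − Y x w`. -/
theorem compF_dzF_toF_apply (Y : MKer 4 Unit) (x : Site 4) (α : Fin 4) (w : Site 4) (b : Unit) :
    compF (dzF (d := 3)) (toF Y) (x, α) (w, b) = Y (x + unitVec α) w () () - Y x w () () := by
  simp only [compF, Finset.univ_unique, Finset.sum_singleton]
  exact tsum_dzKer_mul (d := 3) α x (fun p => Y p w () ())

/-- [folklore] `compF (djF κ u) Ỹ` is the row action of `Ḋ`: `(Ḋ∘Ỹ)((x,α))(w) = [x = u ∧ α = κ]·Y (u+e_κ) w`. -/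
theorem compF_djF_toF_apply (Y : MKer 4 Unit) (x : Site 4) (α : Fin 4) (w : Site 4) (b : Unit) :
    compF (djF κ u) (toF Y) (x, α) (w, b) = if x = u ∧ α = κ then Y (u + unitVec κ) w () () else 0 := by
  simp only [compF, Finset.univ_unique, Finset.sum_singleton]
  exact tsum_djMat_mul κ u x α (fun p => Y p w () ())

/-- [folklore] **THE FORMAL ANCHOR OF THE SIGN DICTIONARY**: leaf-05-g3's bond-level `Ḋ`-terms of the jet of `D_U∘Y∘D_U*` ARE `dYḊᵀ − ḊYdᵀ` in the
fibred-kernel currency — `toF (dJetSw κ u Y) = D₀∘Ỹ∘Ḋᵀ − Ḋ∘Ỹ∘D₀ᵀ`.  Under THE CONVENTION `ε = +1` of PART 1 the same jet reads `ḊỸdᵀ − dỸḊᵀ`, the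
negative: J5's bond tables are in the `ε = −1` convention (see THE SIGN DICTIONARY above).  Pure bookkeeping; no summability hypothesis on `Y`. -/
theorem toF_dJetSw_eq_jets (Y : MKer 4 Unit) : toF (dJetSw κ u Y)
    = compF (compF (dzF (d := 3)) (toF Y)) (trF (djF κ u)) - compF (compF (djF κ u) (toF Y)) (trF (dzF (d := 3))) := by
  funext ⟨x, α⟩ ⟨z, β⟩
  rw [Pi.sub_apply, Pi.sub_apply, toF_apply, dJetSw_apply]
  have h1 : compF (compF (dzF (d := 3)) (toF Y)) (trF (djF κ u)) (x, α) (z, β)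
      = if z = u ∧ β = κ then Y (x + unitVec α) (u + unitVec κ) () () - Y x (u + unitVec κ) () () else 0 := by
    have e : compF (compF (dzF (d := 3)) (toF Y)) (trF (djF κ u)) (x, α) (z, β)
        = ∑' w, compF (dzF (d := 3)) (toF Y) (x, α) (w, ()) * djMat κ u z β w := by
      simp only [compF, Finset.univ_unique, Finset.sum_singleton, trF_apply]
      rfl
    rw [e, tsum_mul_djMat, compF_dzF_toF_apply]
  have h2 : compF (compF (djF κ u) (toF Y)) (trF (dzF (d := 3))) (x, α) (z, β)
      = if x = u ∧ α = κ then Y (u + unitVec κ) (z + unitVec β) () () - Y (u + unitVec κ) z () () else 0 := by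
    have e : compF (compF (djF κ u) (toF Y)) (trF (dzF (d := 3))) (x, α) (z, β)
        = ∑' w, compF (djF κ u) (toF Y) (x, α) (w, ()) * dzKer β z w := by
      simp only [compF, Finset.univ_unique, Finset.sum_singleton, trF_apply]
      rfl
    rw [e, tsum_mul_dzKer, compF_djF_toF_apply, compF_djF_toF_apply]
    split_ifs <;> ring
  rw [h1, h2]

end Summit.QuantumFields.BalabanUV.Beta.D1BFx.CoframeFactorJets

end
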